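import Mathlib

/-!
# Merge defect of a whole family of petals (sub-family decomposition)

Normalised multi-coin petal values `V_j = c + ∑_i ε_i u_{ji}` with `c + ∑_i ε_i = 1` and usages `u_{ji} = 1 + α_{ji}`; the MERGED
petal of a family `S` has usages `∏_{j∈S} u_{ji}`.  The two-petal identity of `…SunflowerMergeDefect` generalises to
`∏_{j∈S} V_j − V(∘S) = ∑_{T ⊆ S} D_T − c`,  `D_T := ∏_{j∈T} e_j − ∑_i ε_i ∏_{j∈T} α_{ji}`,  `e_j := ∑_i ε_i α_{ji} = V_j − 1`
(`merge_defect_family`), where `D_∅ = c` (`mergeTerm_empty`) and `D_{{j}} = 0` (`mergeTerm_singleton`), so that only sub-families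
with at least two petals contribute: the defect of a family is the sum of the generalised defects of its sub-families (prove-1 g54
memo §7(g)(xi); the `|T| = 2` terms are the pair defects bounded by the leverage pot in `…SunflowerPhiZeroPairFull`).  [this work]
-/

namespace Summit.CriticalPhenomena.PercolationContinuityZ3.Theorems.SunflowerPartition.SafeCalc.LinkedCurrency

open Finset

variable {ι κ : Type*}

/-- `D_∅ = 1 − ∑ ε_i = c`. [this work] -/
theorem mergeTerm_empty (I : Finset ι) (ε : ι → ℝ) (α : κ → ι → ℝ) (c : ℝ) (hc : c + ∑ i ∈ I, ε i = 1) :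
    (∏ j ∈ (∅ : Finset κ), (∑ i ∈ I, ε i * α j i) - ∑ i ∈ I, ε i * ∏ j ∈ (∅ : Finset κ), α j i) = c := by
  simp only [prod_empty, mul_one]
  linarith

/-- `D_{{j}} = 0`: single petals have no defect. [this work] -/
theorem mergeTerm_singleton (I : Finset ι) (ε : ι → ℝ) (α : κ → ι → ℝ) (j : κ) :
    (∏ j' ∈ ({j} : Finset κ), (∑ i ∈ I, ε i * α j' i) - ∑ i ∈ I, ε i * ∏ j' ∈ ({j} : Finset κ), α j' i) = 0 := by
  simp

/-- **Merge defect of a family = sum of the generalised defects of its sub-families.**  With `c + ∑_i ε_i = 1`,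
`∏_{j∈S} (c + ∑_i ε_i (1 + α_{ji})) − (c + ∑_i ε_i ∏_{j∈S} (1 + α_{ji})) = ∑_{T ∈ 𝒫(S)} D_T − c`
(and `D_∅ = c`, `D_{{j}} = 0`, so the right side is the sum over sub-families with at least two petals). [this work] -/
theorem merge_defect_family [DecidableEq κ] (I : Finset ι) (S : Finset κ) (ε : ι → ℝ) (α : κ → ι → ℝ) (c : ℝ)
    (hc : c + ∑ i ∈ I, ε i = 1) :
    ∏ j ∈ S, (c + ∑ i ∈ I, ε i * (1 + α j i)) - (c + ∑ i ∈ I, ε i * ∏ j ∈ S, (1 + α j i)) =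
      ∑ T ∈ S.powerset, (∏ j ∈ T, (∑ i ∈ I, ε i * α j i) - ∑ i ∈ I, ε i * ∏ j ∈ T, α j i) - c := by
  -- each petal value is 1 + e_j
  have hV : ∀ j, c + ∑ i ∈ I, ε i * (1 + α j i) = 1 + ∑ i ∈ I, ε i * α j i := by
    intro j
    have : ∑ i ∈ I, ε i * (1 + α j i) = ∑ i ∈ I, ε i + ∑ i ∈ I, ε i * α j i := by
      rw [← sum_add_distrib]; exact sum_congr rfl fun i _ => by ring
    rw [this]; linarith
  simp_rw [hV]
  -- expand both products over sub-families
  rw [prod_one_add]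
  have hU : ∀ i, ∏ j ∈ S, (1 + α j i) = ∑ T ∈ S.powerset, ∏ j ∈ T, α j i := fun i => prod_one_add _
  simp_rw [hU, mul_sum]
  rw [sum_comm]
  simp only [sum_sub_distrib]
  ring

/-- The same identity with the trivial sub-families removed: only `T ⊆ S` with `2 ≤ |T|` contribute. [this work] -/
theorem merge_defect_family' [DecidableEq κ] (I : Finset ι) (S : Finset κ) (ε : ι → ℝ) (α : κ → ι → ℝ) (c : ℝ)
    (hc : c + ∑ i ∈ I, ε i = 1) :
    ∏ j ∈ S, (c + ∑ i ∈ I, ε i * (1 + α j i)) - (c + ∑ i ∈ I, ε i * ∏ j ∈ S, (1 + α j i)) =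
      ∑ T ∈ S.powerset with 2 ≤ T.card, (∏ j ∈ T, (∑ i ∈ I, ε i * α j i) - ∑ i ∈ I, ε i * ∏ j ∈ T, α j i) := by
  rw [merge_defect_family I S ε α c hc]
  -- split the powerset sum into card < 2 and card ≥ 2
  rw [← sum_filter_add_sum_filter_not S.powerset (fun T => 2 ≤ T.card)]
  have hsmall : ∑ T ∈ S.powerset with ¬ 2 ≤ T.card,
      (∏ j ∈ T, (∑ i ∈ I, ε i * α j i) - ∑ i ∈ I, ε i * ∏ j ∈ T, α j i) = c := by
    -- the sub-families with < 2 elements are ∅ and the singletons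
    have hsplit : (S.powerset.filter fun T => ¬ 2 ≤ T.card) = insert ∅ (S.image fun j => ({j} : Finset κ)) := by
      ext T
      simp only [mem_filter, mem_powerset, not_le, mem_insert, mem_image]
      constructor
      · rintro ⟨hT, hcard⟩
        rcases Nat.lt_succ_iff.1 hcard |>.eq_or_lt with h1 | h0
        · obtain ⟨j, hj⟩ := card_eq_one.1 h1
          right; exact ⟨j, hT (by rw [hj]; exact mem_singleton_self j), hj.symm⟩
        · left; exact card_eq_zero.1 (Nat.lt_one_iff.1 h0)
      · rintro (rfl | ⟨j, hj, rfl⟩)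
        · exact ⟨empty_subset _, by simp⟩
        · exact ⟨singleton_subset_iff.2 hj, by simp⟩
    rw [hsplit, sum_insert]
    · rw [mergeTerm_empty I ε α c hc, sum_image]
      · simp
      · intro x _ y _ h; exact singleton_injective h
    · simp only [mem_image, not_exists, not_and]
      intro j _ h; exact (singleton_ne_empty j) h
  rw [hsmall]; ring

end Summit.CriticalPhenomena.PercolationContinuityZ3.Theorems.SunflowerPartition.SafeCalc.LinkedCurrency
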